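import Summits.BirchSwinnertonDyer.Rank1Residual.Additive.TameBranchWildCharacter
import HarnessLib

/-!
# Class N10, tame branch: the intrinsic Gauss sum `τ(ε, ψ_κ)` is a FIXED Gauss sum up to a value of
# `ε̄` — its absolute value does not depend on `κ` (cell `b2b-bsdres`, lane CLASS-CLOSURE, seat
# cc-typer-2; n1011-lit GEN 3 `LIT-INPUTS-P3.md` §19.4 (s2), made a kernel lemma)

HONEST FRAMING (cell `b2b-bsdres`, run/shared/lean/b2b/bsd-rank1-residual/, verbatim in every
file): the goal of the cell is to DELETE the COMBINATION-SHAPED residual classes of the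
Birch–Swinnerton-Dyer formula for ALL analytic-rank `≤ 1` elliptic curves over `ℚ` — "full BSD
formula for every rank `≤ 1` curve in class `C`" assembled STRICTLY from published theorems — so
that the rank-`≤ 1` remainder becomes exactly the CONSTRUCTION-SHAPED classes, which are TYPED
(missing-input `Prop`s), NOT attempted. This is not "finishing BSD". Lane CLASS-CLOSURE
(coordinator ruling 2026-08-21T04:07Z): research routes, no claim beyond the stated classes;
census output = EVIDENCE / conjecture items with held-out validation, NEVER a Literature fact;
the class N10 stays CONSTRUCTION-shaped (RESIDUAL-MAP §I); NOTHING is booked. THEOREMS ONLY; no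
definition, no named fact, no conjecture node; labels / RESIDUAL-MAP marks UNCHANGED.

## What

The interpolation rows of `IsTameBranchOf f p ε α B` (`TameBranchLower.lean` §1) carry the constant
`α^{−m}·p^{−1}·τ(ε, ψ_κ)` with the INTRINSIC Gauss sum `τ(ε, ψ_κ) = ∑_t ε(t) κ(1 + t p^{m−1})`
(`tameGaussSum`; `= gaussSum ε ψ_κ` for the wild additive character `ψ_κ = wildAddChar hm κ`,
`TameBranchWildCharacter.lean`). n1011-lit GEN 3 (§19.3–19.4, independent re-derivation) records
`τ(ε, ψ_κ) = ε̄(c_κ)·τ(ε, ψ)` for a fixed additive character `ψ` (`ψ_κ = ψ(c_κ ·)`), so that the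
constant has the SAME valuation at every `κ` — the property the unit-coefficient certificate of
`TameBranchLower.lean` §3 / `TameBranchCensusJoin.lean` (LOWER chain) is read against (values of
`B` at `κ(γ) − 1` vs. E's twisted symbol sums, cc-eng-3's ENG-D tables). This file proves it:

* `AddChar.apply_eq_apply_one_pow_val` — an additive character of `ℤ/p` is `t ↦ ψ(1)^t`;
* `AddChar.exists_eq_mulShift_of_isPrimitive` — for `ψ` PRIMITIVE on `ℤ/p` (values in a domain),
  every additive character is `ψ.mulShift c` (`ψ(1)` is a primitive `p`-th root of unity and the
  `p`-th roots of unity are its powers, Mathlib `IsPrimitiveRoot.eq_pow_of_pow_eq_one`);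
* `exists_wildAddChar_eq_mulShift` — for `κ` primitive of conductor `p^m`, `m ≥ 2`:
  `ψ_κ = ψ.mulShift c` with `c` a UNIT (`ψ_κ ≠ 1`, `wildAddChar_ne_one`);
* `exists_apply_mul_tameGaussSum_eq` — `ε(c) · τ(ε, ψ_κ) = τ(ε, ψ)` (Mathlib `gaussSum_mulShift`),
  i.e. `τ(ε, ψ_κ) = ε̄(c) · τ(ε, ψ)`;
* `norm_tameGaussSum_eq_norm_gaussSum`, `norm_tameGaussSum_eq` — `‖τ(ε, ψ_κ)‖ = ‖τ(ε, ψ)‖`, hence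
  `‖τ(ε, ψ_κ)‖ = ‖τ(ε, ψ_{κ'})‖` for all primitive `κ`, `κ'` of levels `≥ 2` (`ε(c)` is a
  `(p−1)`-st root of unity, of norm `1`).

Pure character bookkeeping; nothing about elliptic curves is asserted; nothing booked.

References: Mazur–Tate–Teitelbaum, Invent. Math. 84 (1986) §I.8 (Gauss sums against additive
characters; shape, primary not page-checked on this hub — flag `MTT86-primary-unreadable-on-hub`)
[MazurTateTeitelbaum1986Invent]; HOME/cells/n1011/LIT-INPUTS-P3.md §19 (n1011-lit GEN 3).
-/

noncomputable section

open scoped Classical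

namespace Summit.BirchSwinnertonDyer.Rank1Residual.Additive

open Literature.NumberTheory.EllipticCurves

/-! ### §1 Additive characters of `ℤ/p`: all are shifts of a primitive one -/

section AddCharZModPrime

variable {p : ℕ} [hp : Fact p.Prime] {R : Type*} [CommRing R] [IsDomain R]

omit [IsDomain R] in
/-- An additive character of `ℤ/p` is `t ↦ ψ(1)^t` (`t` represented in `[0, p)`). [folklore] -/
theorem AddChar.apply_eq_apply_one_pow_val (ψ : AddChar (ZMod p) R) (t : ZMod p) :
    ψ t = ψ 1 ^ t.val := by
  have ht : t = t.val • (1 : ZMod p) := by rw [nsmul_one, ZMod.natCast_zmod_val]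
  conv_lhs => rw [ht]
  exact AddChar.map_nsmul_eq_pow ψ t.val 1

omit [IsDomain R] in
/-- `ψ(1)^p = 1` for an additive character `ψ` of `ℤ/p`. [folklore] -/
theorem AddChar.apply_one_pow_eq_one (ψ : AddChar (ZMod p) R) : ψ 1 ^ p = 1 := by
  rw [← AddChar.map_nsmul_eq_pow, nsmul_one, ZMod.natCast_self, AddChar.map_zero_eq_one]

omit [IsDomain R] in
/-- For a PRIMITIVE additive character `ψ` of `ℤ/p`, `ψ(1)` is a primitive `p`-th root of unity.
[folklore] -/
theorem AddChar.isPrimitiveRoot_apply_one {ψ : AddChar (ZMod p) R} (hψ : ψ.IsPrimitive) :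
    IsPrimitiveRoot (ψ 1) p := by
  have h1 : ψ 1 ≠ 1 := by
    intro h
    apply hψ (one_ne_zero : (1 : ZMod p) ≠ 0)
    rw [AddChar.mulShift_one]
    ext t
    rw [AddChar.apply_eq_apply_one_pow_val, h, one_pow, AddChar.one_apply]
  have hord : orderOf (ψ 1) = p := orderOf_eq_prime (AddChar.apply_one_pow_eq_one ψ) h1
  refine IsPrimitiveRoot.mk_of_lt (ψ 1) hp.out.pos (AddChar.apply_one_pow_eq_one ψ) ?_
  intro l hl0 hlp hl
  have hdvd : orderOf (ψ 1) ∣ l := orderOf_dvd_of_pow_eq_one hl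
  rw [hord] at hdvd
  exact absurd (Nat.le_of_dvd hl0 hdvd) (not_le.mpr hlp)

/-- **Every additive character of `ℤ/p` is a shift of a primitive one**: for `ψ` primitive and any
`ψ'`, `ψ' = ψ.mulShift c` for some `c ∈ ℤ/p` (the `p`-th roots of unity in a domain are the powers of
the primitive one `ψ(1)`). [folklore] -/
theorem AddChar.exists_eq_mulShift_of_isPrimitive {ψ : AddChar (ZMod p) R} (hψ : ψ.IsPrimitive)
    (ψ' : AddChar (ZMod p) R) : ∃ c : ZMod p, ψ' = ψ.mulShift c := by
  haveI : NeZero p := ⟨hp.out.ne_zero⟩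
  obtain ⟨i, -, hi⟩ := (AddChar.isPrimitiveRoot_apply_one hψ).eq_pow_of_pow_eq_one
    (AddChar.apply_one_pow_eq_one ψ')
  refine ⟨(i : ZMod p), ?_⟩
  ext t
  rw [AddChar.mulShift_apply, AddChar.apply_eq_apply_one_pow_val ψ',
    AddChar.apply_eq_apply_one_pow_val ψ, ← hi, ← pow_mul, ZMod.val_mul, ZMod.val_natCast]
  -- `ζ^{i·t} = ζ^{(i % p)·t % p}` because `ζ^p = 1`
  have hζ : ψ 1 ^ p = 1 := AddChar.apply_one_pow_eq_one ψ
  have key : ∀ n : ℕ, ψ 1 ^ n = ψ 1 ^ (n % p) := fun n ↦ by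
    conv_lhs => rw [← Nat.div_add_mod n p, pow_add, pow_mul, hζ, one_pow, one_mul]
  rw [key (i * t.val)]
  congr 1
  conv_rhs => rw [Nat.mul_mod, Nat.mod_mod]
  exact Nat.mul_mod _ _ _

end AddCharZModPrime

/-! ### §2 The intrinsic Gauss sum against a fixed additive character -/

section GaussShift

variable {p : ℕ} [hp : Fact p.Prime] {m : ℕ}

/-- **`ψ_κ` is a UNIT shift of any primitive additive character** of `ℤ/p`: for `κ` primitive of
conductor `p^m`, `m ≥ 2`, and `ψ` primitive, `ψ_κ = ψ.mulShift c` with `c ∈ (ℤ/p)^×` (`c ≠ 0`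
because `ψ_κ ≠ 1`, `wildAddChar_ne_one`). [folklore] -/
theorem exists_wildAddChar_eq_mulShift (hm : 2 ≤ m) {κ : DirichletCharacter ℂ_[p] (p ^ m)}
    (hκ : κ.IsPrimitive) {ψ : AddChar (ZMod p) ℂ_[p]} (hψ : ψ.IsPrimitive) :
    ∃ c : (ZMod p)ˣ, wildAddChar hm κ = ψ.mulShift (c : ZMod p) := by
  obtain ⟨c, hc⟩ := AddChar.exists_eq_mulShift_of_isPrimitive hψ (wildAddChar hm κ)
  have hc0 : c ≠ 0 := by
    rintro rfl
    exact wildAddChar_ne_one hm hκ (by rw [hc, AddChar.mulShift_zero])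
  exact ⟨Units.mk0 c hc0, by rw [Units.val_mk0, hc]⟩

/-- **`ε(c) · τ(ε, ψ_κ) = τ(ε, ψ)`** for the unit `c` with `ψ_κ = ψ.mulShift c` — i.e.
`τ(ε, ψ_κ) = ε̄(c)·τ(ε, ψ)`: the intrinsic Gauss sum is a FIXED Gauss sum up to a value of `ε̄`
(Mathlib `gaussSum_mulShift`; n1011-lit GEN 3 §19.3 'BONUS'). [folklore] -/
theorem exists_apply_mul_tameGaussSum_eq (hm : 2 ≤ m) (ε : DirichletCharacter ℂ_[p] p)
    {κ : DirichletCharacter ℂ_[p] (p ^ m)} (hκ : κ.IsPrimitive) {ψ : AddChar (ZMod p) ℂ_[p]}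
    (hψ : ψ.IsPrimitive) :
    ∃ c : (ZMod p)ˣ, wildAddChar hm κ = ψ.mulShift (c : ZMod p) ∧
      ε c * tameGaussSum p ε κ = gaussSum ε ψ := by
  obtain ⟨c, hc⟩ := exists_wildAddChar_eq_mulShift hm hκ hψ
  exact ⟨c, hc, by rw [tameGaussSum_eq_gaussSum hm, hc, gaussSum_mulShift]⟩

/-- A value of a character mod `p` at a unit has norm `1` in `ℂ_p` (it is a `(p−1)`-st root of
unity). [folklore] -/
theorem norm_apply_units_eq_one (ε : DirichletCharacter ℂ_[p] p) (c : (ZMod p)ˣ) :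
    ‖ε c‖ = 1 := by
  have hpow : ε c ^ (p - 1) = 1 := by
    rw [← map_pow, ← Units.val_pow_eq_pow_val, ZMod.units_pow_card_sub_one_eq_one, Units.val_one,
      map_one]
  have h1 : ‖ε c‖ ^ (p - 1) = 1 := by rw [← norm_pow, hpow, norm_one]
  have hp1 : p - 1 ≠ 0 := by have := hp.out.two_le; omega
  exact (pow_eq_one_iff_of_nonneg (norm_nonneg _) hp1).mp h1

/-- **`‖τ(ε, ψ_κ)‖ = ‖τ(ε, ψ)‖`** for every primitive additive character `ψ` of `ℤ/p` and every
primitive `κ` of conductor `p^m`, `m ≥ 2`. [folklore] -/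
theorem norm_tameGaussSum_eq_norm_gaussSum (hm : 2 ≤ m) (ε : DirichletCharacter ℂ_[p] p)
    {κ : DirichletCharacter ℂ_[p] (p ^ m)} (hκ : κ.IsPrimitive) {ψ : AddChar (ZMod p) ℂ_[p]}
    (hψ : ψ.IsPrimitive) :
    ‖tameGaussSum p ε κ‖ = ‖gaussSum ε ψ‖ := by
  obtain ⟨c, -, hc⟩ := exists_apply_mul_tameGaussSum_eq hm ε hκ hψ
  rw [← hc, norm_mul, norm_apply_units_eq_one, one_mul]

/-- **The absolute value of the intrinsic Gauss sum does not depend on `κ`**: for primitive `κ`,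
`κ'` of conductors `p^m`, `p^{m'}` (`m, m' ≥ 2`), `‖τ(ε, ψ_κ)‖ = ‖τ(ε, ψ_{κ'})‖` — so the constants
`α^{−m} p^{−1} τ(ε, ψ_κ)` of the interpolation rows of `IsTameBranchOf` have ONE valuation
(given `‖α‖ = 1`), uniformly in the row. [folklore] -/
theorem norm_tameGaussSum_eq (hm : 2 ≤ m) {m' : ℕ} (hm' : 2 ≤ m') (ε : DirichletCharacter ℂ_[p] p)
    {κ : DirichletCharacter ℂ_[p] (p ^ m)} (hκ : κ.IsPrimitive)
    {κ' : DirichletCharacter ℂ_[p] (p ^ m')} (hκ' : κ'.IsPrimitive) :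
    ‖tameGaussSum p ε κ‖ = ‖tameGaussSum p ε κ'‖ := by
  rw [norm_tameGaussSum_eq_norm_gaussSum hm ε hκ (isPrimitive_wildAddChar hm' hκ'),
    tameGaussSum_eq_gaussSum hm']

end GaussShift

end Summit.BirchSwinnertonDyer.Rank1Residual.Additive

end
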